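import Summits.AtomisticToContinuum.HydrodynamicLimit.Theorems.StiffCollisionalRelaxationAprioriBoundsFibreDefsR4
import Summits.AtomisticToContinuum.HydrodynamicLimit.Theorems.StiffCollisionalRelaxationAprioriBoundsPartTwoOfKineticRangeControl
import Summits.AtomisticToContinuum.HydrodynamicLimit.Theorems.AprioriBounds.Negative.ExpMomentTangent
import HarnessLib

/-!
# The in-mean floor of the kernel block density from component (ii) and from `KineticRangeControl`
(line `meso-chebyshev-window`, crux `StiffCollisionalRelaxation.AprioriBounds`, stmt-AtomisticToContinuum-14827)

Helper file (`--supports stmt-AtomisticToContinuum-14827`), DOCK of the registered stub `stub_meanFloor`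
(stub 1 of `Cruxes/AprioriBounds/Lines/meso_chebyshev_window.lean`, OPEN IN KIND, `producer: none`).

Stub 1 asks, under the crux prefix, for a FLOOR IN THE MEAN of the kernel block density
`ρ̄_φ(s,x)(z) = empiricalDensityField ((Φ N).flow s z) (fun y => φ N (y - x))`, uniform on the space–time
grid: `∃ m > 0 ∃ N₀ ∀ N ≥ N₀ ∀ s ∈ [0,t] ∀ x, m ≤ E_{P_N} ρ̄_φ(s,x)`.  This file kernel-checks the two
comparisons stated in the stub's docstring:

* `meanFloor_of_badEvent_tendsto` — **the floor in the mean is implied by component (ii) at the same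
  instance**: if the `P_N` are probability laws, the kernels are continuous and nonnegative, and
  `P_N{∃ s ≤ t ∃ x, ρ̄ < c₁ ∨ 1 < ρ̄σ³} → 0` for some `c₁ > 0`, then the floor holds with `m := c₁/2`.
  Proof: Markov (`mul_meas_ge_le_integral_of_nonneg`, `ρ̄ ≥ 0`, `ρ̄` bounded measurable hence integrable)
  gives `c₁ · P_N{c₁ ≤ ρ̄(s,x)} ≤ E ρ̄(s,x)`; the event `{c₁ ≤ ρ̄(s,x)}` contains the complement of the bad
  event, whose outer measure is `≥ 1 − P_N(bad) ≥ 1/2` for `N ≥ N₀` (`measure_univ_le_add_compl`, no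
  measurability of the uncountable-union bad event is needed).
* `meanFloor_of_partTwo` — the same at the level of the crux prefix: any producer of component (ii) in the
  crux's `∃ σ₀ ∃ η₁ ∀ σ < σ₀ …` shape produces stub 1 (shrink `σ₀` below `1/2` so that the laws are
  probability measures, `isProbabilityMeasure_localGibbsLaw`).
* `meanFloor_of_kineticRangeControl` — **stub 1 from stmt-AtomisticToContinuum-9201**
  (`GermanoSplitLES.KineticRangeControl`, the import every other line on this crux used for (ii)), by
  composing with the landed glue `AdiabatCeiling.partTwo_of_kineticRangeControl` (p121015).

So stub 1 is WEAKER than (ii) and than 9201; it is not implied by the macroscopic conjunct (no rate, no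
mesoscale) and has no producer of its own in the tree.  No new definitions, no named facts; axioms `propext`,
`Classical.choice`, `Quot.sound`.
-/

noncomputable section

open MeasureTheory ProbabilityTheory Filter Set Topology
open scoped ENNReal

namespace Summit.AtomisticToContinuum.HydrodynamicLimit.Theorems.MesoChebyshevWindow

open Literature.MathematicalPhysics.KineticTheory Literature.Analysis.FluidPDE
open Summit.AtomisticToContinuum.HydrodynamicLimit.Theorems.AprioriBoundsNegative (PartOneAt PartTwoAt)
open Summit.AtomisticToContinuum.HydrodynamicLimit.Theorems.VisitLedgerUpscattering (Cfg Flow Flows NiceProfiles)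
open Summit.AtomisticToContinuum.HydrodynamicLimit.Theorems.FibreDeficitTransfer

/-! ## The block density as a random variable: measurable, nonnegative, bounded, integrable -/

/-- The tested empirical density `z ↦ (N+1)⁻¹ ∑ᵢ χ(xᵢ)` is measurable in the configuration for
continuous `χ`. [folklore] -/
theorem measurable_empiricalDensityField_cfg {N : ℕ} {χ : T3 → ℝ} (hχ : Continuous χ) :
    Measurable fun w : Config (N + 1) (Fin 3) T3 => empiricalDensityField w χ := by
  have h : (fun w : Config (N + 1) (Fin 3) T3 => empiricalDensityField w χ) =
      fun w => ((N + 1 : ℕ) : ℝ)⁻¹ * ∑ i, χ (w i).1 :=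
    funext fun w => AprioriBoundsNegative.empiricalDensityField_eq_sum w χ
  rw [h]
  exact (Finset.measurable_sum _ fun i _ =>
    hχ.measurable.comp (measurable_pi_apply i).fst).const_mul _

/-- The tested empirical density of a nonnegative test function is nonnegative. [folklore] -/
theorem empiricalDensityField_nonneg_cfg {N : ℕ} {χ : T3 → ℝ} (hχ0 : ∀ y, 0 ≤ χ y)
    (w : Config (N + 1) (Fin 3) T3) : 0 ≤ empiricalDensityField w χ := by
  rw [AprioriBoundsNegative.empiricalDensityField_eq_sum]
  exact mul_nonneg (by positivity) (Finset.sum_nonneg fun i _ => hχ0 _)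

/-- The tested empirical density of a test function bounded by `K` in absolute value is bounded by `K`
in absolute value. [folklore] -/
theorem abs_empiricalDensityField_le_cfg {N : ℕ} {χ : T3 → ℝ} {K : ℝ} (hK : ∀ y, |χ y| ≤ K)
    (w : Config (N + 1) (Fin 3) T3) : |empiricalDensityField w χ| ≤ K := by
  rw [AprioriBoundsNegative.empiricalDensityField_eq_sum, abs_mul, abs_of_nonneg (by positivity)]
  calc ((N + 1 : ℕ) : ℝ)⁻¹ * |∑ i, χ (w i).1|
      ≤ ((N + 1 : ℕ) : ℝ)⁻¹ * ∑ _i : Fin (N + 1), K :=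
        mul_le_mul_of_nonneg_left ((Finset.abs_sum_le_sum_abs _ _).trans
          (Finset.sum_le_sum fun i _ => hK _)) (by positivity)
    _ = K := by
        rw [Finset.sum_const, Finset.card_univ, Fintype.card_fin, nsmul_eq_mul, ← mul_assoc,
          inv_mul_cancel₀ (by positivity), one_mul]

/-- The kernel block density along a hard-sphere flow, `z ↦ ρ̄(Φ_s z, x)`, is integrable under every
finite law (continuous kernel: bounded on the compact torus; measurable through `Φ.measurable_flow`).
[folklore] -/
theorem integrable_blockDensity_flow {σ : ℝ} {N : ℕ}
    (Φ : HardSphereFlow (Torus.geometry (Fin 3)) (hsDiameter σ N) (N + 1))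
    (μ : Measure (Config (N + 1) (Fin 3) T3)) [IsFiniteMeasure μ] {φ : T3 → ℝ} (hφ : Continuous φ)
    (s : ℝ) (x : T3) :
    Integrable (fun z => empiricalDensityField (Φ.flow s z) (fun y => φ (y - x))) μ := by
  have hχ : Continuous fun y : T3 => φ (y - x) := hφ.comp (continuous_sub_right x)
  obtain ⟨K, -, hK⟩ := exists_forall_abs_le_of_continuous hχ
  refine Integrable.of_bound
    ((measurable_empiricalDensityField_cfg hχ).comp (Φ.measurable_flow s)).aestronglyMeasurable K
    (ae_of_all _ fun z => ?_)
  rw [Real.norm_eq_abs]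
  exact abs_empiricalDensityField_le_cfg hK _

/-! ## The floor in the mean from the bad event of component (ii) -/

/-- **Floor in the mean from component (ii) at one instance.**  If the laws `P_N` are probability
measures, the kernels `φ_N` are continuous and nonnegative, and for some `c₁ > 0` the bad event of
component (ii), `{∃ s ∈ [0,t] ∃ x, ρ̄ < c₁ ∨ 1 < ρ̄σ³}`, has `P_N`-probability `→ 0`, then
`∃ m > 0 ∃ N₀ ∀ N ≥ N₀ ∀ s ∈ [0,t] ∀ x, m ≤ E_{P_N} ρ̄(s,x)` with `m := c₁/2`: Markov's inequality for the
nonnegative integrable `ρ̄(s,x)` and `P_N{c₁ ≤ ρ̄(s,x)} ≥ P_N(badᶜ) ≥ 1 − P_N(bad) ≥ 1/2`. [folklore] -/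
theorem meanFloor_of_badEvent_tendsto {σ : ℝ} {a₀ θ₀ : T3 → ℝ} {u₀ : T3 → V3}
    {Φ : (N : ℕ) → HardSphereFlow (Torus.geometry (Fin 3)) (hsDiameter σ N) (N + 1)} {t : ℝ}
    (hP : ∀ N, IsProbabilityMeasure (localGibbsLaw σ a₀ u₀ θ₀ N (Φ N)))
    {φ : ℕ → T3 → ℝ} (hφc : ∀ N, Continuous (φ N)) (hφ0 : ∀ N y, 0 ≤ φ N y) {c₁ : ℝ} (hc₁ : 0 < c₁)
    (hT : Tendsto (fun N : ℕ => localGibbsLaw σ a₀ u₀ θ₀ N (Φ N)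
      {z | ∃ s ∈ Icc 0 t, ∃ x : T3,
        empiricalDensityField ((Φ N).flow s z) (fun y => φ N (y - x)) < c₁ ∨
          1 < empiricalDensityField ((Φ N).flow s z) (fun y => φ N (y - x)) * σ ^ 3}) atTop (𝓝 0)) :
    ∃ m : ℝ, 0 < m ∧ ∃ N₀ : ℕ, ∀ N : ℕ, N₀ ≤ N → ∀ s ∈ Icc 0 t, ∀ x : T3,
      m ≤ ∫ z, empiricalDensityField ((Φ N).flow s z) (fun y => φ N (y - x))
        ∂(localGibbsLaw σ a₀ u₀ θ₀ N (Φ N)) := by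
  obtain ⟨N₀, hN₀⟩ := ENNReal.tendsto_atTop_zero.1 hT 2⁻¹ (by simp)
  refine ⟨c₁ / 2, half_pos hc₁, N₀, fun N hN s hs x => ?_⟩
  set μ := localGibbsLaw σ a₀ u₀ θ₀ N (Φ N) with hμ
  set bad : Set (Config (N + 1) (Fin 3) T3) := {z | ∃ s ∈ Icc 0 t, ∃ x : T3,
    empiricalDensityField ((Φ N).flow s z) (fun y => φ N (y - x)) < c₁ ∨
      1 < empiricalDensityField ((Φ N).flow s z) (fun y => φ N (y - x)) * σ ^ 3} with hbad
  set F : Config (N + 1) (Fin 3) T3 → ℝ :=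
    fun z => empiricalDensityField ((Φ N).flow s z) (fun y => φ N (y - x)) with hF
  have hF0 : ∀ z, 0 ≤ F z := fun z => empiricalDensityField_nonneg_cfg (fun y => hφ0 N (y - x)) _
  have hFi : Integrable F μ := integrable_blockDensity_flow (Φ N) μ (hφc N) s x
  -- Markov: `c₁ · P{c₁ ≤ F} ≤ E F`
  have hmarkov : c₁ * μ.real {z | c₁ ≤ F z} ≤ ∫ z, F z ∂μ :=
    mul_meas_ge_le_integral_of_nonneg (ae_of_all _ hF0) hFi c₁
  -- the good event contains the complement of the bad event
  have hsub : badᶜ ⊆ {z | c₁ ≤ F z} := by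
    intro z hz
    simp only [hbad, Set.mem_compl_iff, Set.mem_setOf_eq, not_exists, not_and, not_or, not_lt] at hz
    exact (hz s hs x).1
  -- `P(badᶜ) ≥ 1 - P(bad) ≥ 1/2` (outer measure; no measurability needed)
  have hbadle : μ bad ≤ 2⁻¹ := hN₀ N hN
  have hhalf : (2⁻¹ : ℝ≥0∞) ≤ μ {z | c₁ ≤ F z} := by
    haveI := hP N
    have h1 : (1 : ℝ≥0∞) ≤ μ bad + μ badᶜ := (measure_univ (μ := μ)).symm.le.trans
      (measure_univ_le_add_compl bad)
    calc (2⁻¹ : ℝ≥0∞) = 1 - 2⁻¹ := ENNReal.one_sub_inv_two.symm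
      _ ≤ (μ bad + μ badᶜ) - 2⁻¹ := tsub_le_tsub_right h1 _
      _ ≤ (2⁻¹ + μ badᶜ) - 2⁻¹ := tsub_le_tsub_right (add_le_add hbadle le_rfl) _
      _ = μ badᶜ := ENNReal.add_sub_cancel_left (by simp)
      _ ≤ μ {z | c₁ ≤ F z} := measure_mono hsub
  have hreal : (1 / 2 : ℝ) ≤ μ.real {z | c₁ ≤ F z} := by
    have h := ENNReal.toReal_mono (measure_ne_top μ _) hhalf
    rw [ENNReal.toReal_inv, ENNReal.toReal_ofNat] at h
    rw [measureReal_def, one_div]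
    exact h
  calc c₁ / 2 = c₁ * (1 / 2) := by ring
    _ ≤ c₁ * μ.real {z | c₁ ≤ F z} := by gcongr
    _ ≤ ∫ z, F z ∂μ := hmarkov

/-! ## Stub 1 from any producer of component (ii) in the crux's shape, and from stmt-9201 -/

/-- **Stub 1 (`stub_meanFloor`) from component (ii) in the crux's shape.**  If component (ii) holds under
the crux prefix (`∃ σ₀ ∃ η₁ ∀ σ < σ₀ …`, bad-event form), then so does the floor in the mean: shrink `σ₀`
to `min σ₀ (1/2)` (probability laws, `isProbabilityMeasure_localGibbsLaw`) and apply
`meanFloor_of_badEvent_tendsto` with the admissible kernels' continuity (`IsSmooth`) and sign. [folklore] -/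
theorem meanFloor_of_partTwo
    (h2 : ∀ (a₀ θ₀ : T3 → ℝ) (u₀ : T3 → V3), Continuous a₀ → Continuous θ₀ → Continuous u₀ →
      (∀ x, 0 < a₀ x) → (∀ x, 0 < θ₀ x) →
      ∃ σ₀ : ℝ, 0 < σ₀ ∧ ∃ η₁ : ℝ, 0 < η₁ ∧ ∀ σ : ℝ, 0 < σ → σ < σ₀ →
        ∀ (T : ℝ) (ρ θ : ℝ → T3 → ℝ) (u : ℝ → T3 → V3), IsHardSphereEulerSolution σ T ρ u θ →
        ∀ Φ : (N : ℕ) → HardSphereFlow (Torus.geometry (Fin 3)) (hsDiameter σ N) (N + 1),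
          TendstoHydroFieldsAt (fun N => localGibbsLaw σ a₀ u₀ θ₀ N (Φ N)) Φ ρ u θ 0 →
          ∀ t : ℝ, 0 < t → t < T → (∀ s ∈ Icc 0 t, ∀ x, 2 * ρ s x * σ ^ 3 < η₁) →
          ∀ (γ C : ℝ) (φ : ℕ → T3 → ℝ), 0 < γ → γ ≤ 1 / 15 →
            ((∀ N, Literature.Analysis.FunctionSpaces.Torus.IsSmooth (φ N)) ∧ (∀ N y, 0 ≤ φ N y) ∧
              (∀ N, ∫ y, φ N y = 1) ∧
              (∀ (N : ℕ) y, ((N : ℝ) + 1) ^ (-γ) ≤ Torus.euclidDist y 0 → φ N y = 0) ∧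
              (∀ (N : ℕ) y, φ N y ≤ C * ((N : ℝ) + 1) ^ (3 * γ)) ∧
              (∀ (N : ℕ) y, ‖Literature.Analysis.FunctionSpaces.Torus.gradient (φ N) y‖ ≤
                C * ((N : ℝ) + 1) ^ (4 * γ))) →
            ∃ c₁ : ℝ, 0 < c₁ ∧ Tendsto (fun N : ℕ => localGibbsLaw σ a₀ u₀ θ₀ N (Φ N)
              {z | ∃ s ∈ Icc 0 t, ∃ x : T3,
                empiricalDensityField ((Φ N).flow s z) (fun y => φ N (y - x)) < c₁ ∨
                  1 < empiricalDensityField ((Φ N).flow s z) (fun y => φ N (y - x)) * σ ^ 3})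
              atTop (𝓝 0)) :
    ∀ (a₀ θ₀ : T3 → ℝ) (u₀ : T3 → V3), Continuous a₀ → Continuous θ₀ → Continuous u₀ →
      (∀ x, 0 < a₀ x) → (∀ x, 0 < θ₀ x) →
      ∃ σ₀ : ℝ, 0 < σ₀ ∧ ∃ η₁ : ℝ, 0 < η₁ ∧ ∀ σ : ℝ, 0 < σ → σ < σ₀ →
        ∀ (T : ℝ) (ρ θ : ℝ → T3 → ℝ) (u : ℝ → T3 → V3), IsHardSphereEulerSolution σ T ρ u θ →
        ∀ Φ : (N : ℕ) → HardSphereFlow (Torus.geometry (Fin 3)) (hsDiameter σ N) (N + 1),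
          TendstoHydroFieldsAt (fun N => localGibbsLaw σ a₀ u₀ θ₀ N (Φ N)) Φ ρ u θ 0 →
          ∀ t : ℝ, 0 < t → t < T → (∀ s ∈ Icc 0 t, ∀ x, 2 * ρ s x * σ ^ 3 < η₁) →
          ∀ (γ C : ℝ) (φ : ℕ → T3 → ℝ), 0 < γ → γ ≤ 1 / 15 →
            ((∀ N, Literature.Analysis.FunctionSpaces.Torus.IsSmooth (φ N)) ∧ (∀ N y, 0 ≤ φ N y) ∧
              (∀ N, ∫ y, φ N y = 1) ∧
              (∀ (N : ℕ) y, ((N : ℝ) + 1) ^ (-γ) ≤ Torus.euclidDist y 0 → φ N y = 0) ∧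
              (∀ (N : ℕ) y, φ N y ≤ C * ((N : ℝ) + 1) ^ (3 * γ)) ∧
              (∀ (N : ℕ) y, ‖Literature.Analysis.FunctionSpaces.Torus.gradient (φ N) y‖ ≤
                C * ((N : ℝ) + 1) ^ (4 * γ))) →
            ∃ m : ℝ, 0 < m ∧ ∃ N₀ : ℕ, ∀ N : ℕ, N₀ ≤ N → ∀ s ∈ Icc 0 t, ∀ x : T3,
              m ≤ ∫ z, empiricalDensityField ((Φ N).flow s z) (fun y => φ N (y - x))
                ∂(localGibbsLaw σ a₀ u₀ θ₀ N (Φ N)) := by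
  intro a₀ θ₀ u₀ ha hθ hu ha0 hθ0
  obtain ⟨σ₀, hσ₀, η₁, hη₁, H⟩ := h2 a₀ θ₀ u₀ ha hθ hu ha0 hθ0
  refine ⟨min σ₀ (1 / 2), lt_min hσ₀ one_half_pos, η₁, hη₁, ?_⟩
  intro σ hσ hσlt T ρ θ u hsol Φ hLLN t ht htT hdil γ C φ hγ hγ' hadm
  have hσ₀' : σ < σ₀ := hσlt.trans_le (min_le_left _ _)
  have hσ2 : σ ≤ 1 / 2 := (hσlt.trans_le (min_le_right _ _)).le
  have hP : ∀ N, IsProbabilityMeasure (localGibbsLaw σ a₀ u₀ θ₀ N (Φ N)) := fun N =>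
    isProbabilityMeasure_localGibbsLaw ha hθ hu ha0 hθ0 hσ2 N (Φ N)
  obtain ⟨c₁, hc₁, hT⟩ := H σ hσ hσ₀' T ρ θ u hsol Φ hLLN t ht htT hdil γ C φ hγ hγ' hadm
  exact meanFloor_of_badEvent_tendsto hP (fun N => (hadm.1 N).continuous) hadm.2.1 hc₁ hT

/-- **Stub 1 (`stub_meanFloor`) from stmt-AtomisticToContinuum-9201.**  The crux
`GermanoSplitLES.KineticRangeControl` (no mesoscopic vacuum / dense pockets at any admissible kinetic
filter before the shock, in local-Gibbs probability, uniformly in `(s, x)` inside the event) implies the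
floor in the mean of the kernel block density under the crux prefix: component (ii) by the landed glue
`AdiabatCeiling.partTwo_of_kineticRangeControl`, then `meanFloor_of_partTwo`.  This documents that
stub 1 is weaker than the import every other line on this crux used for (ii). [folklore] -/
theorem meanFloor_of_kineticRangeControl : Summit.AtomisticToContinuum.HydrodynamicLimit.Theses.GermanoSplitLES.KineticRangeControl → ∀ (a₀ θ₀ : T3 → ℝ) (u₀ : T3 → V3), Continuous a₀ → Continuous θ₀ → Continuous u₀ → (∀ x, 0 < a₀ x) → (∀ x, 0 < θ₀ x) → ∃ σ₀ : ℝ, 0 < σ₀ ∧ ∃ η₁ : ℝ, 0 < η₁ ∧ ∀ σ : ℝ, 0 < σ → σ < σ₀ → ∀ (T : ℝ) (ρ θ : ℝ → T3 → ℝ) (u : ℝ → T3 → V3), IsHardSphereEulerSolution σ T ρ u θ → ∀ Φ : (N : ℕ) → HardSphereFlow (Torus.geometry (Fin 3)) (hsDiameter σ N) (N + 1), TendstoHydroFieldsAt (fun N => localGibbsLaw σ a₀ u₀ θ₀ N (Φ N)) Φ ρ u θ 0 → ∀ t : ℝ, 0 < t → t < T → (∀ s ∈ Icc 0 t, ∀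 x, 2 * ρ s x * σ ^ 3 < η₁) → ∀ (γ C : ℝ) (φ : ℕ → T3 → ℝ), 0 < γ → γ ≤ 1 / 15 → ((∀ N, Literature.Analysis.FunctionSpaces.Torus.IsSmooth (φ N)) ∧ (∀ N y, 0 ≤ φ N y) ∧ (∀ N, ∫ y, φ N y = 1) ∧ (∀ (N : ℕ) y, ((N : ℝ) + 1) ^ (-γ) ≤ Torus.euclidDist y 0 → φ N y = 0) ∧ (∀ (N : ℕ) y, φ N y ≤ C * ((N : ℝ) + 1) ^ (3 * γ)) ∧ (∀ (N : ℕ) y, ‖Literature.Analysis.FunctionSpaces.Torus.gradient (φ N) y‖ ≤ C * ((N : ℝ) + 1) ^ (4 * γ))) → ∃ m : ℝ, 0 < m ∧ ∃ N₀ : ℕ, ∀ N : ℕ, N₀ ≤ N → ∀ s ∈ Icc 0 t, ∀ x : T3, m ≤ ∫ z, empiricalDensityField ((Φ N).flow s z) (fun y => φ N (y - x)) ∂(localGibbsLaw σ a₀ u₀ θ₀ N (Φ N)) :=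
  fun hKRC => meanFloor_of_partTwo (AdiabatCeiling.partTwo_of_kineticRangeControl hKRC)

end Summit.AtomisticToContinuum.HydrodynamicLimit.Theorems.MesoChebyshevWindow

end
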